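import Literature.MathematicalPhysics.QuantumFieldTheory.O2ChargedSectorsCells
import Literature.MathematicalPhysics.QuantumFieldTheory.O2NeutralSectorsTail
import HarnessLib

/-!
# O(2) `{φ, s, t}` scan: charged sectors `2⁺` and `1` — kernel term tests on boxes, at the apex, heavy range

[cite: HogervorstRychkov2013, §3 eqs. (3.6), (3.9)] [cite: KosPolandSimmonsduffin2014, §3.3 eq. (3.16), §4 eqs. (4.2)–(4.3)]
[cite: ChesterEtAl2020, §3.1 (functional conditions)] [cite: DolanOsborn2004, §3 eq. (3.11)]

WHAT THIS FILE DOES (engines lane SDP-4, O(2) client path; Lean side only).  After the conjugation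
alignment (`O2ChargeTwoEvenTermwise`, `O2ChargeOneTermwise`) the per-term tests of the two charged
`2 × 2` sectors involve KERNEL VALUES ONLY: at level `q = (n, j)`, `E = Δ + n`,
`2⁺`: `P(E,j) ≥ 0`, `𝔇(E,j) ≥ 0`, `Q♮(E,j)² ≤ 4 P 𝔇`;  `1` (certificate constant `κ > 0`):
`𝔇ˣκ(E,j) ≥ 0`, `𝔇ʸκ(E,j) ≥ 0`, `W¹♮(E,j)² ≤ 4 𝔇ˣκ 𝔇ʸκ` — where every entry is a TWO-WEIGHT EVALUATION
`T(c, d; s)[𝒫_{E,j}] = Σ_m (c_m v_m^s 𝒫_{E,j}(z_m) − d_m u_m^s 𝒫_{E,j}(1−z_m))` of the non-negative kernel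
`𝒫_{E,j}` (`§1`, `kernelTest2p`, `kernelTest1` and the six `(c, d; s)` triples).  Hence the neutral-sector
machinery of `O2NeutralSectorsTail` applies verbatim:
* §2 rule (M) on a box `E ∈ [E₁, E₂]` (`j` fixed): the corner numbers `cornerBound₂` of the three entries
  (`twoWeightEval_mem_Icc_corner`) and the closed-form check `X ≥ 0, Y ≥ 0, Z² ≤ 4 X Y` give the kernel
  test on the whole box (`kernelTest2p_on_box`, `kernelTest1_on_box`);
* §3 rule (T) at the apex: in the dominated node configuration with apex `a` the three apex numbers
  `X_T = c_a v_a^{s} − apexRadTW(c, d; s, E_T)` (two diagonal entries) and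
  `Z_T = |c_a| v_a^{s} + apexRadTW(c, d; s, E_T)` (off-diagonal entry) with `X_T, Y_T ≥ 0`, `Z_T² ≤ 4 X_T Y_T`
  give the kernel test for EVERY `E ≥ E_T`, `j ≤ E` (`kernelTest2p_of_apex`, `kernelTest1_of_apex`) — ONE
  check for the whole far tail, uniformly in `Δ`;
* §4 the HEAVY range: `pos2p_heavy`, `pos1_heavy` — `Pos2p`/`Pos1` at every `(Δ, ℓ)` with
  `unitarityBound3D ℓ ≤ Δ`, `Δ ≥ E₀ > 1` from (M) on `[E₀, E_T)` and (T) on `[E_T, ∞)`;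
* §5 cell tails: `cellTail2p_of_termwise`, `cellTail1_of_termwise` turn (M)/(T) into the tail hypotheses of
  the cell rules `O2ChargedSectorsCells.pos2p_on_cell_Ico` / `pos1_on_cell_Ico`.

HONEST SCOPE.  (i) The inputs of (M)/(T) — corner numbers, apex numbers, the dominated node configuration
`(a, qd, qr)` — are closed-form expressions in the functional's node data; evaluating them with directed
rounding is the reader's job.  (ii) Rule (T) needs the dominated node configuration of
`ConformalBootstrap3D.ZMonoApexDomination` (one node `a` dominating all others at large level); whether a
given functional has one, and how large `E_T` must be, is instance data.  (iii) Nothing here decides an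
instance; no numerics.
honest framing: shared numerical engines serving client cells; rigour lives in the verifiers; every
published number belongs to a client cell's ledger, not to the engines group.

DECLARATIONS.  `kernelTest2p`, `kernelTest1` (the kernel tests as `Prop`s), the weight vectors
`cwP/dwP`, `cwQ/dwQ`, `cwW1/dwW1`, the exponents `expoQ`, `expoW1`; theorems otherwise.  Kind `definition`.

Sources.  Hogervorst–Rychkov, Phys. Rev. D 87 (2013) 106004, §3 eqs. (3.6), (3.9) (`HogervorstRychkov2013`);
Kos–Poland–Simmons-Duffin, JHEP 11 (2014) 109, §3.3 eq. (3.16), §4 eqs. (4.2)–(4.3)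
(`KosPolandSimmonsduffin2014`); Chester–Landry–Liu–Poland–Simmons-Duffin–Su–Vichi, JHEP 06 (2020) 142,
§3.1 (`ChesterEtAl2020`); Dolan–Osborn, Nucl. Phys. B 678 (2004) 491, §3 eq. (3.11) (`DolanOsborn2004`).
-/

namespace Literature.MathematicalPhysics.QuantumFieldTheory.O2ChargedSectorsTail

open Finset Set Matrix Filter Topology
open Literature.MathematicalPhysics.QuantumFieldTheory.O2ThreeScalarCrossing
open Literature.MathematicalPhysics.QuantumFieldTheory.O2ThreeScalarSystem
open Literature.MathematicalPhysics.QuantumFieldTheory.O2OPEScanBridge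
open Literature.MathematicalPhysics.QuantumFieldTheory.O2ScanObligations
open Literature.MathematicalPhysics.QuantumFieldTheory.O2NeutralSectorsTermwise
open Literature.MathematicalPhysics.QuantumFieldTheory.O2ChargedSectorsTermwise
open Literature.MathematicalPhysics.QuantumFieldTheory.O2ChargeTwoEvenTermwise
open Literature.MathematicalPhysics.QuantumFieldTheory.O2ChargeOneTermwise
open Literature.MathematicalPhysics.QuantumFieldTheory.O2ChargedSectorsCells
open Literature.MathematicalPhysics.QuantumFieldTheory.O2NeutralSectorsTail (twoWeightEval_mem_Icc_corner
  apexRadTW apexRadTW_anti_level abs_twoWeightEval_sub_apex_le)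
open ConformalBootstrap3D (IsConformalBlock3D IsRegularPoint3D unitarityBound3D accidentalDegeneracy3D
  crossF zMono zMono_nonneg legendreLam legendreLam_pos InDescendantRange hrCoeff twoWeightEval cornerBound₂
  eventually_isRegularPoint3D_nhdsGT_of_bound_le natCast_add_half_le_unitarityBound3D
  natCast_add_le_of_unitarityBound3D_lt)

/-! ### §1 The kernel tests and their entries as two-weight evaluations -/

/-- **The `2⁺` kernel test at `(E, j)`**: `P ≥ 0`, `𝔇 ≥ 0`, `Q♮² ≤ 4 P 𝔇` for the kernel `𝒫_{E,j}`.
[cite: ChesterEtAl2020, §3.1 ("`M ⪰ 0`")] [cite: HogervorstRychkov2013, §3 eq. (3.9)] -/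
def kernelTest2p (F : ScanFunctional) (D : Dims) (E : ℝ) (j : ℕ) : Prop :=
  0 ≤ pForm2p F D (zMono E j) ∧ 0 ≤ dom2mTerm F D E j ∧
    qForm2pA F D (zMono E j) ^ 2 ≤ 4 * pForm2p F D (zMono E j) * dom2mTerm F D E j

/-- **The sector-`1` kernel test at `(E, j)`** (certificate constant `κ`): `𝔇ˣκ ≥ 0`, `𝔇ʸκ ≥ 0`,
`(W¹♮)² ≤ 4 𝔇ˣκ 𝔇ʸκ` for the kernel `𝒫_{E,j}`. [cite: ChesterEtAl2020, §3.1 ("`M ⪰ 0`")]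
[cite: HogervorstRychkov2013, §3 eq. (3.9)] -/
def kernelTest1 (F : ScanFunctional) (D : Dims) (κ E : ℝ) (j : ℕ) : Prop :=
  0 ≤ domX1Term F D κ E j ∧ 0 ≤ domY1Term F D κ E j ∧
    w1Form1A F D (zMono E j) ^ 2 ≤ 4 * domX1Term F D κ E j * domY1Term F D κ E j

/-- The kernel test gives every `2⁺` term form `𝔗_{n,j}(b, z; Δ) ≥ 0` with `Δ + n = E`.
[cite: ChesterEtAl2020, §3.1 ("`M ⪰ 0`")] [cite: DolanOsborn2004, §3 eq. (3.11)] -/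
theorem dom2pTermForm_nonneg_of_kernelTest (F : ScanFunctional) (D : Dims) {Δ : ℝ} {ℓ n j : ℕ}
    (h : kernelTest2p F D (Δ + (n : ℝ)) j) (b z : ℝ) : 0 ≤ dom2pTermForm F D Δ ℓ n j b z :=
  dom2pTermForm_nonneg_of_test F D h.1 h.2.1 h.2.2 b z

/-- The kernel test gives every sector-`1` term form `𝔗_{n,j}(x, y; Δ) ≥ 0` with `Δ + n = E`.
[cite: ChesterEtAl2020, §3.1 ("`M ⪰ 0`")] [cite: DolanOsborn2004, §3 eq. (3.11)] -/
theorem dom1TermForm_nonneg_of_kernelTest (F : ScanFunctional) (D : Dims) {κ Δ : ℝ} {ℓ n j : ℕ}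
    (h : kernelTest1 F D κ (Δ + (n : ℝ)) j) (x y : ℝ) : 0 ≤ dom1TermForm F D κ Δ ℓ n j x y :=
  dom1TermForm_nonneg_of_test F D h.1 h.2.1 h.2.2 x y

/-- The generic closed-form test from enclosures: `Xlo ≤ X`, `Ylo ≤ Y`, `|Z| ≤ Zabs`, `Xlo, Ylo ≥ 0`,
`Zabs² ≤ 4 Xlo Ylo` ⇒ `X ≥ 0 ∧ Y ≥ 0 ∧ Z² ≤ 4 X Y`. [cite: ChesterEtAl2020, §3.1 ("`M ⪰ 0`")] -/
theorem test_of_enclosures {X Y Z Xlo Ylo Zabs : ℝ} (hX : Xlo ≤ X) (hY : Ylo ≤ Y) (hZ : |Z| ≤ Zabs)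
    (h0X : 0 ≤ Xlo) (h0Y : 0 ≤ Ylo) (hdet : Zabs ^ 2 ≤ 4 * Xlo * Ylo) :
    0 ≤ X ∧ 0 ≤ Y ∧ Z ^ 2 ≤ 4 * X * Y := by
  refine ⟨h0X.trans hX, h0Y.trans hY, ?_⟩
  have hZ2 : Z ^ 2 ≤ Zabs ^ 2 := by
    rw [← sq_abs Z]
    exact pow_le_pow_left₀ (abs_nonneg Z) hZ 2
  have hXY : Xlo * Ylo ≤ X * Y := mul_le_mul hX hY h0Y (h0X.trans hX)
  nlinarith

/-- Weights of `P` as a two-weight evaluation: `c_P = 2(w¹ + w²)`. [cite: HogervorstRychkov2013, §3 eq. (3.6)] -/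
def cwP (F : ScanFunctional) (m : Fin F.M) : ℝ := 2 * (F.w m 1 + F.w m 2)

/-- `d_P = 2(w¹ − w²)`. [cite: HogervorstRychkov2013, §3 eq. (3.6)] -/
def dwP (F : ScanFunctional) (m : Fin F.M) : ℝ := 2 * (F.w m 1 - F.w m 2)

/-- `P[H] = T(c_P, d_P; Δ_φ)[H]`. [cite: HogervorstRychkov2013, §3 eq. (3.6)]
[cite: ChesterEtAl2020, App. «Crossing vectors» (`V⃗_{2,Δ,ℓ⁺}`)] -/
theorem pForm2p_eq_twoWeightEval (F : ScanFunctional) (D : Dims) (H : ℝ → ℝ → ℝ) :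
    pForm2p F D H = twoWeightEval (cwP F) (dwP F) F.z F.zb (D.expo .φφφφ) H := by
  simp only [pForm2p, twoWeightEval, nodeEval_apply, crossF, Finset.mul_sum, ← Finset.sum_add_distrib]
  exact Finset.sum_congr rfl fun m _ => by simp only [cwP, dwP]; ring

/-- Weights of `Q♮`: `c_Q = 2(w²⁰ − w²¹)`. [cite: HogervorstRychkov2013, §3 eq. (3.6)] -/
def cwQ (F : ScanFunctional) (m : Fin F.M) : ℝ := 2 * (F.w m 20 - F.w m 21)

/-- `d_Q = 2(w²⁰ + w²¹)`. [cite: HogervorstRychkov2013, §3 eq. (3.6)] -/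
def dwQ (F : ScanFunctional) (m : Fin F.M) : ℝ := 2 * (F.w m 20 + F.w m 21)

/-- The aligned `Q♮` exponent `(Δφ+Δs)/2 + (Δt−Δs)/2`. [cite: DolanOsborn2011, §2 eqs. (2.43)–(2.44)] -/
noncomputable def expoQ (D : Dims) : ℝ := D.expo .φφst + (D.Δt - D.Δs) / 2

/-- `Q♮[H] = T(c_Q, d_Q; expoQ)[H]`. [cite: HogervorstRychkov2013, §3 eq. (3.6)]
[cite: ChesterEtAl2020, App. «Crossing vectors» (`V⃗_{2,Δ,ℓ⁺}`)] -/
theorem qForm2pA_eq_twoWeightEval (F : ScanFunctional) (D : Dims) (H : ℝ → ℝ → ℝ) :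
    qForm2pA F D H = twoWeightEval (cwQ F) (dwQ F) F.z F.zb (expoQ D) H := by
  simp only [qForm2pA, expoQ, twoWeightEval, nodeEval_apply, crossF, Finset.mul_sum,
    ← Finset.sum_sub_distrib]
  exact Finset.sum_congr rfl fun m _ => by simp only [cwQ, dwQ]; ring

/-- `𝔇(E, j) = T(c₂, d₂; Δ_t-slot exponent)[𝒫_{E,j}]` (by definition). [cite: PappadopuloRychkovEspinRattazzi2012, §5] -/
theorem dom2mTerm_eq_twoWeightEval (F : ScanFunctional) (D : Dims) (E : ℝ) (j : ℕ) :
    dom2mTerm F D E j = twoWeightEval (cWeight2m F) (dWeight2m F) F.z F.zb (D.expo .stts) (zMono E j) :=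
  rfl

/-- Weights of `W¹♮`: `c_W = d_W = 2w¹⁹`. [cite: HogervorstRychkov2013, §3 eq. (3.6)] -/
def cwW1 (F : ScanFunctional) (m : Fin F.M) : ℝ := 2 * F.w m 19

/-- The aligned `W¹♮` exponent. [cite: DolanOsborn2011, §2 eqs. (2.43)–(2.44)] -/
noncomputable def expoW1 (D : Dims) : ℝ := D.expo .φsφt - (-(D.Δt - D.Δφ) - (D.Δφ - D.Δs)) / 2

/-- `W¹♮[H] = T(c_W, c_W; expoW1)[H]`. [cite: HogervorstRychkov2013, §3 eq. (3.6)]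
[cite: ChesterEtAl2020, App. «Crossing vectors» (`V⃗_{1,Δ,ℓ}`)] -/
theorem w1Form1A_eq_twoWeightEval (F : ScanFunctional) (D : Dims) (H : ℝ → ℝ → ℝ) :
    w1Form1A F D H = twoWeightEval (cwW1 F) (cwW1 F) F.z F.zb (expoW1 D) H := by
  simp only [w1Form1A, expoW1, twoWeightEval, nodeEval_apply, crossF, Finset.mul_sum]
  exact Finset.sum_congr rfl fun m _ => by simp only [cwW1]; ring

/-- `𝔇ˣκ(E, j) = T(cˣ, dˣ; Δ_φ)[𝒫_{E,j}]` (by definition). [cite: PappadopuloRychkovEspinRattazzi2012, §5] -/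
theorem domX1Term_eq_twoWeightEval (F : ScanFunctional) (D : Dims) (κ E : ℝ) (j : ℕ) :
    domX1Term F D κ E j =
      twoWeightEval (cWeightX1 F κ) (dWeightX1 F κ) F.z F.zb (D.expo .sφφs) (zMono E j) :=
  rfl

/-- `𝔇ʸκ(E, j) = T(cʸ, dʸ; Δ_t)[𝒫_{E,j}]` (by definition). [cite: PappadopuloRychkovEspinRattazzi2012, §5] -/
theorem domY1Term_eq_twoWeightEval (F : ScanFunctional) (D : Dims) (κ E : ℝ) (j : ℕ) :
    domY1Term F D κ E j =
      twoWeightEval (cWeightY1 F κ) (dWeightY1 F κ) F.z F.zb (D.expo .φttφ) (zMono E j) :=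
  rfl

/-! ### §2 Rule (M): the kernel tests on a box `E ∈ [E₁, E₂]` -/

/-- `lo ≤ x ≤ hi ⇒ |x| ≤ max (−lo) hi`. Bookkeeping. [cite: HogervorstRychkov2013, §3 eq. (3.6)] -/
private theorem abs_le_max_of_mem' {x lo hi : ℝ} (h1 : lo ≤ x) (h2 : x ≤ hi) : |x| ≤ max (-lo) hi := by
  rw [abs_le]
  exact ⟨by linarith [le_max_left (-lo) hi], h2.trans (le_max_right _ _)⟩

/-- **Rule (M), sector `2⁺`**: on the box `E ∈ [E₁, E₂]` (`j` fixed) the corner numbers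
`X = cornerBound₂(c_P, d_P; Δφ)`, `Y = cornerBound₂(c₂, d₂; s_{stts})`,
`Z = max(−cornerBound₂(c_Q, d_Q; expoQ), −cornerBound₂(−c_Q, −d_Q; expoQ))` with `X, Y ≥ 0`, `Z² ≤ 4 X Y`
give the `2⁺` kernel test at every `E` of the box. [cite: HogervorstRychkov2013, §3 eqs. (3.6), (3.9)] -/
theorem kernelTest2p_on_box (F : ScanFunctional) (D : Dims) (j : ℕ) {E₁ E₂ : ℝ}
    (hX : 0 ≤ cornerBound₂ (cwP F) (dwP F) F.z F.zb j E₁ E₂ (D.expo .φφφφ) (D.expo .φφφφ))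
    (hY : 0 ≤ cornerBound₂ (cWeight2m F) (dWeight2m F) F.z F.zb j E₁ E₂ (D.expo .stts) (D.expo .stts))
    (hdet : max (-cornerBound₂ (cwQ F) (dwQ F) F.z F.zb j E₁ E₂ (expoQ D) (expoQ D))
        (-cornerBound₂ (-cwQ F) (-dwQ F) F.z F.zb j E₁ E₂ (expoQ D) (expoQ D)) ^ 2 ≤
      4 * cornerBound₂ (cwP F) (dwP F) F.z F.zb j E₁ E₂ (D.expo .φφφφ) (D.expo .φφφφ) *
        cornerBound₂ (cWeight2m F) (dWeight2m F) F.z F.zb j E₁ E₂ (D.expo .stts) (D.expo .stts)) :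
    ∀ E ∈ Icc E₁ E₂, kernelTest2p F D E j := by
  intro E hE
  have hP := twoWeightEval_mem_Icc_corner F (cwP F) (dwP F) j hE (D.expo .φφφφ)
  have hD := twoWeightEval_mem_Icc_corner F (cWeight2m F) (dWeight2m F) j hE (D.expo .stts)
  have hQ := twoWeightEval_mem_Icc_corner F (cwQ F) (dwQ F) j hE (expoQ D)
  rw [← pForm2p_eq_twoWeightEval] at hP
  rw [← dom2mTerm_eq_twoWeightEval] at hD
  rw [← qForm2pA_eq_twoWeightEval] at hQ
  exact test_of_enclosures hP.1 hD.1 (abs_le_max_of_mem' hQ.1 hQ.2) hX hY hdet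

/-- **Rule (M), sector `1`** (certificate constant `κ`): corner numbers
`X = cornerBound₂(cˣ, dˣ; Δφ)`, `Y = cornerBound₂(cʸ, dʸ; Δt)`,
`Z = max(−cornerBound₂(c_W, c_W; expoW1), −cornerBound₂(−c_W, −c_W; expoW1))` with `X, Y ≥ 0`,
`Z² ≤ 4 X Y` give the sector-`1` kernel test on the box. [cite: HogervorstRychkov2013, §3 eqs. (3.6), (3.9)] -/
theorem kernelTest1_on_box (F : ScanFunctional) (D : Dims) (κ : ℝ) (j : ℕ) {E₁ E₂ : ℝ}
    (hX : 0 ≤ cornerBound₂ (cWeightX1 F κ) (dWeightX1 F κ) F.z F.zb j E₁ E₂ (D.expo .sφφs) (D.expo .sφφs))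
    (hY : 0 ≤ cornerBound₂ (cWeightY1 F κ) (dWeightY1 F κ) F.z F.zb j E₁ E₂ (D.expo .φttφ) (D.expo .φttφ))
    (hdet : max (-cornerBound₂ (cwW1 F) (cwW1 F) F.z F.zb j E₁ E₂ (expoW1 D) (expoW1 D))
        (-cornerBound₂ (-cwW1 F) (-cwW1 F) F.z F.zb j E₁ E₂ (expoW1 D) (expoW1 D)) ^ 2 ≤
      4 * cornerBound₂ (cWeightX1 F κ) (dWeightX1 F κ) F.z F.zb j E₁ E₂ (D.expo .sφφs) (D.expo .sφφs) *
        cornerBound₂ (cWeightY1 F κ) (dWeightY1 F κ) F.z F.zb j E₁ E₂ (D.expo .φttφ) (D.expo .φttφ)) :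
    ∀ E ∈ Icc E₁ E₂, kernelTest1 F D κ E j := by
  intro E hE
  have hXe := twoWeightEval_mem_Icc_corner F (cWeightX1 F κ) (dWeightX1 F κ) j hE (D.expo .sφφs)
  have hYe := twoWeightEval_mem_Icc_corner F (cWeightY1 F κ) (dWeightY1 F κ) j hE (D.expo .φttφ)
  have hW := twoWeightEval_mem_Icc_corner F (cwW1 F) (cwW1 F) j hE (expoW1 D)
  rw [← domX1Term_eq_twoWeightEval] at hXe
  rw [← domY1Term_eq_twoWeightEval] at hYe
  rw [← w1Form1A_eq_twoWeightEval] at hW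
  exact test_of_enclosures hXe.1 hYe.1 (abs_le_max_of_mem' hW.1 hW.2) hX hY hdet

/-! ### §3 Rule (T): the kernel tests at the apex, uniformly in the level -/

/-- Apex lower number of a two-weight evaluation: `c_a v_a^s − apexRadTW(c, d; s, T)`.
[cite: HogervorstRychkov2013, §3 eq. (3.6)] -/
noncomputable def apexLoTW (F : ScanFunctional) (c d : Fin F.M → ℝ) (a : Fin F.M) (qd qr : Fin F.M → ℝ)
    (s T : ℝ) : ℝ :=
  c a * ((1 - F.z a) * (1 - F.zb a)) ^ s - apexRadTW F c d a qd qr s T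

/-- Apex absolute number of a two-weight evaluation: `|c_a v_a^s| + apexRadTW(c, d; s, T)`.
[cite: HogervorstRychkov2013, §3 eq. (3.6)] -/
noncomputable def apexAbsTW (F : ScanFunctional) (c d : Fin F.M → ℝ) (a : Fin F.M) (qd qr : Fin F.M → ℝ)
    (s T : ℝ) : ℝ :=
  |c a * ((1 - F.z a) * (1 - F.zb a)) ^ s| + apexRadTW F c d a qd qr s T

/-- **Apex lower bound**: `𝒫_{E,j}(z_a) · apexLoTW(…, E_T) ≤ T(c, d; s)[𝒫_{E,j}]` for `E ≥ E_T`, `j ≤ E` in the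
dominated node configuration. [cite: HogervorstRychkov2013, §3 eq. (3.6)] -/
theorem apexLoTW_mul_le_twoWeightEval (F : ScanFunctional) (hord : ∀ m, F.zb m ≤ F.z m) (a : Fin F.M)
    (qd qr : Fin F.M → ℝ) (hqd : ∀ m, 0 < qd m ∧ qd m ≤ 1) (hqr : ∀ m, 0 < qr m ∧ qr m ≤ 1)
    (hdomd : ∀ m, F.z m * F.zb m ≤ qd m ^ 2 * (F.z a * F.zb a) ∧ F.z m ≤ qd m * F.z a)
    (hdomr : ∀ m, (1 - F.z m) * (1 - F.zb m) ≤ qr m ^ 2 * (F.z a * F.zb a) ∧ 1 - F.zb m ≤ qr m * F.z a)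
    {ET E : ℝ} (hE : ET ≤ E) {j : ℕ} (hjE : (j : ℝ) ≤ E) (c d : Fin F.M → ℝ) (s : ℝ) :
    zMono E j (F.z a) (F.zb a) * apexLoTW F c d a qd qr s ET ≤ twoWeightEval c d F.z F.zb s (zMono E j) := by
  have hP : 0 ≤ zMono E j (F.z a) (F.zb a) := zMono_nonneg E j (F.hz a).1.le (F.hzb a).1.le
  have h := abs_twoWeightEval_sub_apex_le F hord a qd qr (fun m => (hqd m).1) (fun m => (hqr m).1) hdomd
    hdomr hjE c d s
  have hanti := apexRadTW_anti_level F c d a hqd hqr s hE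
  have hR := mul_le_mul_of_nonneg_left hanti hP
  rw [apexLoTW]
  linarith [(abs_le.1 h).1]

/-- **Apex absolute bound**: `|T(c, d; s)[𝒫_{E,j}]| ≤ 𝒫_{E,j}(z_a) · apexAbsTW(…, E_T)` for `E ≥ E_T`,
`j ≤ E`. [cite: HogervorstRychkov2013, §3 eq. (3.6)] -/
theorem abs_twoWeightEval_le_mul_apexAbsTW (F : ScanFunctional) (hord : ∀ m, F.zb m ≤ F.z m) (a : Fin F.M)
    (qd qr : Fin F.M → ℝ) (hqd : ∀ m, 0 < qd m ∧ qd m ≤ 1) (hqr : ∀ m, 0 < qr m ∧ qr m ≤ 1)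
    (hdomd : ∀ m, F.z m * F.zb m ≤ qd m ^ 2 * (F.z a * F.zb a) ∧ F.z m ≤ qd m * F.z a)
    (hdomr : ∀ m, (1 - F.z m) * (1 - F.zb m) ≤ qr m ^ 2 * (F.z a * F.zb a) ∧ 1 - F.zb m ≤ qr m * F.z a)
    {ET E : ℝ} (hE : ET ≤ E) {j : ℕ} (hjE : (j : ℝ) ≤ E) (c d : Fin F.M → ℝ) (s : ℝ) :
    |twoWeightEval c d F.z F.zb s (zMono E j)| ≤ zMono E j (F.z a) (F.zb a) * apexAbsTW F c d a qd qr s ET := by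
  have hP : 0 ≤ zMono E j (F.z a) (F.zb a) := zMono_nonneg E j (F.hz a).1.le (F.hzb a).1.le
  have h := abs_twoWeightEval_sub_apex_le F hord a qd qr (fun m => (hqd m).1) (fun m => (hqr m).1) hdomd
    hdomr hjE c d s
  have hanti := apexRadTW_anti_level F c d a hqd hqr s hE
  have hR := mul_le_mul_of_nonneg_left hanti hP
  set T := twoWeightEval c d F.z F.zb s (zMono E j)
  set P := zMono E j (F.z a) (F.zb a)
  set K := c a * ((1 - F.z a) * (1 - F.zb a)) ^ s
  have htri : |T| ≤ |T - K * P| + |K * P| := by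
    have := abs_add_le (T - K * P) (K * P)
    rwa [sub_add_cancel] at this
  have hKP : |K * P| = |K| * P := by rw [abs_mul, abs_of_nonneg hP]
  rw [apexAbsTW]
  calc |T| ≤ |T - K * P| + |K * P| := htri
    _ ≤ P * apexRadTW F c d a qd qr s E + |K| * P := add_le_add h hKP.le
    _ ≤ P * apexRadTW F c d a qd qr s ET + |K| * P := by linarith [hR]
    _ = P * (|K| + apexRadTW F c d a qd qr s ET) := by ring

/-- **Three apex numbers decide a kernel-type test for the whole far tail**: for three weight triples,
`X_T = apexLoTW₁(E_T) ≥ 0`, `Y_T = apexLoTW₂(E_T) ≥ 0`, `Z_T = apexAbsTW₃(E_T)`, `Z_T² ≤ 4 X_T Y_T` give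
`T₁ ≥ 0 ∧ T₂ ≥ 0 ∧ T₃² ≤ 4 T₁ T₂` at every `𝒫_{E,j}` with `E ≥ E_T`, `j ≤ E`.
[cite: HogervorstRychkov2013, §3 eqs. (3.6), (3.9)] -/
theorem test_of_apex (F : ScanFunctional) (hord : ∀ m, F.zb m ≤ F.z m) (a : Fin F.M)
    (qd qr : Fin F.M → ℝ) (hqd : ∀ m, 0 < qd m ∧ qd m ≤ 1) (hqr : ∀ m, 0 < qr m ∧ qr m ≤ 1)
    (hdomd : ∀ m, F.z m * F.zb m ≤ qd m ^ 2 * (F.z a * F.zb a) ∧ F.z m ≤ qd m * F.z a)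
    (hdomr : ∀ m, (1 - F.z m) * (1 - F.zb m) ≤ qr m ^ 2 * (F.z a * F.zb a) ∧ 1 - F.zb m ≤ qr m * F.z a)
    (c₁ d₁ c₂ d₂ c₃ d₃ : Fin F.M → ℝ) (s₁ s₂ s₃ : ℝ) {ET : ℝ}
    (hX : 0 ≤ apexLoTW F c₁ d₁ a qd qr s₁ ET) (hY : 0 ≤ apexLoTW F c₂ d₂ a qd qr s₂ ET)
    (hdet : apexAbsTW F c₃ d₃ a qd qr s₃ ET ^ 2 ≤
      4 * apexLoTW F c₁ d₁ a qd qr s₁ ET * apexLoTW F c₂ d₂ a qd qr s₂ ET) :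
    ∀ E : ℝ, ET ≤ E → ∀ j : ℕ, (j : ℝ) ≤ E →
      0 ≤ twoWeightEval c₁ d₁ F.z F.zb s₁ (zMono E j) ∧ 0 ≤ twoWeightEval c₂ d₂ F.z F.zb s₂ (zMono E j) ∧
        twoWeightEval c₃ d₃ F.z F.zb s₃ (zMono E j) ^ 2 ≤
          4 * twoWeightEval c₁ d₁ F.z F.zb s₁ (zMono E j) * twoWeightEval c₂ d₂ F.z F.zb s₂ (zMono E j) := by
  intro E hE j hjE
  have hP : 0 ≤ zMono E j (F.z a) (F.zb a) := zMono_nonneg E j (F.hz a).1.le (F.hzb a).1.le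
  have h1 := apexLoTW_mul_le_twoWeightEval F hord a qd qr hqd hqr hdomd hdomr hE hjE c₁ d₁ s₁
  have h2 := apexLoTW_mul_le_twoWeightEval F hord a qd qr hqd hqr hdomd hdomr hE hjE c₂ d₂ s₂
  have h3 := abs_twoWeightEval_le_mul_apexAbsTW F hord a qd qr hqd hqr hdomd hdomr hE hjE c₃ d₃ s₃
  refine test_of_enclosures h1 h2 h3 (mul_nonneg hP hX) (mul_nonneg hP hY) ?_
  have h := mul_le_mul_of_nonneg_left hdet (sq_nonneg (zMono E j (F.z a) (F.zb a)))
  calc (zMono E j (F.z a) (F.zb a) * apexAbsTW F c₃ d₃ a qd qr s₃ ET) ^ 2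
      = zMono E j (F.z a) (F.zb a) ^ 2 * apexAbsTW F c₃ d₃ a qd qr s₃ ET ^ 2 := by ring
    _ ≤ zMono E j (F.z a) (F.zb a) ^ 2 *
        (4 * apexLoTW F c₁ d₁ a qd qr s₁ ET * apexLoTW F c₂ d₂ a qd qr s₂ ET) := h
    _ = _ := by ring

/-- **Rule (T), sector `2⁺`**: the three apex numbers of `(c_P, d_P; Δφ)`, `(c₂, d₂; s_{stts})`,
`(c_Q, d_Q; expoQ)` at `E_T` give the `2⁺` kernel test for every `E ≥ E_T`, `j ≤ E`.
[cite: HogervorstRychkov2013, §3 eqs. (3.6), (3.9)] -/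
theorem kernelTest2p_of_apex (F : ScanFunctional) (D : Dims) (hord : ∀ m, F.zb m ≤ F.z m) (a : Fin F.M)
    (qd qr : Fin F.M → ℝ) (hqd : ∀ m, 0 < qd m ∧ qd m ≤ 1) (hqr : ∀ m, 0 < qr m ∧ qr m ≤ 1)
    (hdomd : ∀ m, F.z m * F.zb m ≤ qd m ^ 2 * (F.z a * F.zb a) ∧ F.z m ≤ qd m * F.z a)
    (hdomr : ∀ m, (1 - F.z m) * (1 - F.zb m) ≤ qr m ^ 2 * (F.z a * F.zb a) ∧ 1 - F.zb m ≤ qr m * F.z a)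
    {ET : ℝ} (hX : 0 ≤ apexLoTW F (cwP F) (dwP F) a qd qr (D.expo .φφφφ) ET)
    (hY : 0 ≤ apexLoTW F (cWeight2m F) (dWeight2m F) a qd qr (D.expo .stts) ET)
    (hdet : apexAbsTW F (cwQ F) (dwQ F) a qd qr (expoQ D) ET ^ 2 ≤
      4 * apexLoTW F (cwP F) (dwP F) a qd qr (D.expo .φφφφ) ET *
        apexLoTW F (cWeight2m F) (dWeight2m F) a qd qr (D.expo .stts) ET) :
    ∀ E : ℝ, ET ≤ E → ∀ j : ℕ, (j : ℝ) ≤ E → kernelTest2p F D E j := by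
  intro E hE j hjE
  have h := test_of_apex F hord a qd qr hqd hqr hdomd hdomr (cwP F) (dwP F) (cWeight2m F) (dWeight2m F)
    (cwQ F) (dwQ F) (D.expo .φφφφ) (D.expo .stts) (expoQ D) hX hY hdet E hE j hjE
  rw [← pForm2p_eq_twoWeightEval, ← dom2mTerm_eq_twoWeightEval, ← qForm2pA_eq_twoWeightEval] at h
  exact h

/-- **Rule (T), sector `1`** (certificate constant `κ`): the three apex numbers of `(cˣ, dˣ; Δφ)`,
`(cʸ, dʸ; Δt)`, `(c_W, c_W; expoW1)` at `E_T` give the sector-`1` kernel test for every `E ≥ E_T`, `j ≤ E`.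
[cite: HogervorstRychkov2013, §3 eqs. (3.6), (3.9)] -/
theorem kernelTest1_of_apex (F : ScanFunctional) (D : Dims) (κ : ℝ) (hord : ∀ m, F.zb m ≤ F.z m)
    (a : Fin F.M) (qd qr : Fin F.M → ℝ) (hqd : ∀ m, 0 < qd m ∧ qd m ≤ 1) (hqr : ∀ m, 0 < qr m ∧ qr m ≤ 1)
    (hdomd : ∀ m, F.z m * F.zb m ≤ qd m ^ 2 * (F.z a * F.zb a) ∧ F.z m ≤ qd m * F.z a)
    (hdomr : ∀ m, (1 - F.z m) * (1 - F.zb m) ≤ qr m ^ 2 * (F.z a * F.zb a) ∧ 1 - F.zb m ≤ qr m * F.z a)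
    {ET : ℝ} (hX : 0 ≤ apexLoTW F (cWeightX1 F κ) (dWeightX1 F κ) a qd qr (D.expo .sφφs) ET)
    (hY : 0 ≤ apexLoTW F (cWeightY1 F κ) (dWeightY1 F κ) a qd qr (D.expo .φttφ) ET)
    (hdet : apexAbsTW F (cwW1 F) (cwW1 F) a qd qr (expoW1 D) ET ^ 2 ≤
      4 * apexLoTW F (cWeightX1 F κ) (dWeightX1 F κ) a qd qr (D.expo .sφφs) ET *
        apexLoTW F (cWeightY1 F κ) (dWeightY1 F κ) a qd qr (D.expo .φttφ) ET) :
    ∀ E : ℝ, ET ≤ E → ∀ j : ℕ, (j : ℝ) ≤ E → kernelTest1 F D κ E j := by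
  intro E hE j hjE
  have h := test_of_apex F hord a qd qr hqd hqr hdomd hdomr (cWeightX1 F κ) (dWeightX1 F κ)
    (cWeightY1 F κ) (dWeightY1 F κ) (cwW1 F) (cwW1 F) (D.expo .sφφs) (D.expo .φttφ) (expoW1 D)
    hX hY hdet E hE j hjE
  rw [← domX1Term_eq_twoWeightEval, ← domY1Term_eq_twoWeightEval, ← w1Form1A_eq_twoWeightEval] at h
  exact h

/-! ### §4 The heavy range `Δ ≥ E₀` from (M) and (T) -/

/-- **Heavy range, sector `2⁺`, regular point** (twist-gap domain, `E₀ > 1`): the kernel test for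
`E ∈ [E₀, E_T)`, `j + τ ≤ E` (rule (M); `τ ≤ 1`, `τ ≤ E₀`) and for `E ≥ E_T`, `j ≤ E` (rule (T)) gives the
`2⁺` sector form `≥ 0` on genuine blocks at every regular `(Δ, ℓ)` with `Δ ≥ E₀`.
[cite: HogervorstRychkov2013, §3 eqs. (3.6), (3.9)] [cite: KosPolandSimmonsduffin2014, §3.3 eq. (3.16)] -/
theorem sector2pForm_nonneg_heavy (F : ScanFunctional) (D : Dims) {E₀ ET τ : ℝ} (hτ1 : τ ≤ 1)
    (hτ0 : τ ≤ E₀) (hE₀ : 1 < E₀)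
    (hM : ∀ (j : ℕ) (E : ℝ), E₀ ≤ E → E < ET → (j : ℝ) + τ ≤ E → kernelTest2p F D E j)
    (hT : ∀ E : ℝ, ET ≤ E → ∀ j : ℕ, (j : ℝ) ≤ E → kernelTest2p F D E j)
    {Δ : ℝ} {ℓ : ℕ} (hΔ : unitarityBound3D ℓ < Δ) (hreg : ¬ accidentalDegeneracy3D Δ ℓ) (hΔ0 : E₀ ≤ Δ)
    {G : Label → ℝ → ℝ → ℝ} (hG : ∀ L ∈ labels2p, IsConformalBlock3D (d12 D L) (d34 D L) Δ ℓ (G L))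
    (b z : ℝ) : 0 ≤ sector2pForm F D G b z := by
  have h1 : ℓ = 0 → Δ ≠ 1 := fun _ => (lt_of_lt_of_le hE₀ hΔ0).ne'
  refine sector2pForm_nonneg_of_dom_termwise F D hΔ hreg h1 ∅ (by simp) (fun q _ hq b z => ?_) hG b z
  refine dom2pTermForm_nonneg_of_kernelTest F D ?_ b z
  have hℓτ : (ℓ : ℝ) + τ ≤ Δ := natCast_add_le_of_unitarityBound3D_lt hτ1 hτ0 hΔ hΔ0
  have hj : (q.2 : ℝ) ≤ (ℓ : ℝ) + (q.1 : ℝ) := by exact_mod_cast hq.2.1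
  have hjE : (q.2 : ℝ) + τ ≤ Δ + (q.1 : ℝ) := by linarith
  have hjE' : (q.2 : ℝ) ≤ Δ + (q.1 : ℝ) := by linarith [natCast_add_half_le_unitarityBound3D ℓ]
  have hE0 : E₀ ≤ Δ + (q.1 : ℝ) := hΔ0.trans (le_add_of_nonneg_right (Nat.cast_nonneg _))
  by_cases hlt : Δ + (q.1 : ℝ) < ET
  · exact hM q.2 (Δ + (q.1 : ℝ)) hE0 hlt hjE
  · exact hT (Δ + (q.1 : ℝ)) (not_lt.1 hlt) q.2 hjE'

/-- **Heavy range, sector `1`, regular point** (`|ε| ≤ 1`, certificate constant `κ > 0`, `E₀ > 1`).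
[cite: HogervorstRychkov2013, §3 eqs. (3.6), (3.9)] [cite: KosPolandSimmonsduffin2014, §3.3 eq. (3.16)] -/
theorem sector1Form_nonneg_heavy (F : ScanFunctional) (D : Dims) {ε κ E₀ ET τ : ℝ} (hε : |ε| ≤ 1)
    (hκ : 0 < κ) (hτ1 : τ ≤ 1) (hτ0 : τ ≤ E₀) (hE₀ : 1 < E₀)
    (hM : ∀ (j : ℕ) (E : ℝ), E₀ ≤ E → E < ET → (j : ℝ) + τ ≤ E → kernelTest1 F D κ E j)
    (hT : ∀ E : ℝ, ET ≤ E → ∀ j : ℕ, (j : ℝ) ≤ E → kernelTest1 F D κ E j)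
    {Δ : ℝ} {ℓ : ℕ} (hΔ : unitarityBound3D ℓ < Δ) (hreg : ¬ accidentalDegeneracy3D Δ ℓ) (hΔ0 : E₀ ≤ Δ)
    {G : Label → ℝ → ℝ → ℝ} (hG : ∀ L ∈ labels1, IsConformalBlock3D (d12 D L) (d34 D L) Δ ℓ (G L))
    (x y : ℝ) : 0 ≤ sector1Form F D ε G x y := by
  have h1 : ℓ = 0 → Δ ≠ 1 := fun _ => (lt_of_lt_of_le hE₀ hΔ0).ne'
  refine sector1Form_nonneg_of_dom_termwise F D hε hκ hΔ hreg h1 ∅ (by simp) (fun q _ hq x y => ?_)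
    hG x y
  refine dom1TermForm_nonneg_of_kernelTest F D ?_ x y
  have hℓτ : (ℓ : ℝ) + τ ≤ Δ := natCast_add_le_of_unitarityBound3D_lt hτ1 hτ0 hΔ hΔ0
  have hj : (q.2 : ℝ) ≤ (ℓ : ℝ) + (q.1 : ℝ) := by exact_mod_cast hq.2.1
  have hjE : (q.2 : ℝ) + τ ≤ Δ + (q.1 : ℝ) := by linarith
  have hjE' : (q.2 : ℝ) ≤ Δ + (q.1 : ℝ) := by linarith [natCast_add_half_le_unitarityBound3D ℓ]
  have hE0 : E₀ ≤ Δ + (q.1 : ℝ) := hΔ0.trans (le_add_of_nonneg_right (Nat.cast_nonneg _))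
  by_cases hlt : Δ + (q.1 : ℝ) < ET
  · exact hM q.2 (Δ + (q.1 : ℝ)) hE0 hlt hjE
  · exact hT (Δ + (q.1 : ℝ)) (not_lt.1 hlt) q.2 hjE'

/-- **Heavy range, sector `2⁺`, all points**: `Pos2p` at every `(Δ, ℓ)` with `unitarityBound3D ℓ ≤ Δ` and
`Δ ≥ E₀` (non-regular points by right limits).
[cite: KosPolandSimmonsduffin2014, §3.3 eq. (3.16), §4 eqs. (4.2)–(4.3)] [cite: ChesterEtAl2020, §3.1 (functional conditions)] -/
theorem pos2p_heavy (F : ScanFunctional) (D : Dims) {E₀ ET τ : ℝ} (hτ1 : τ ≤ 1) (hτ0 : τ ≤ E₀)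
    (hE₀ : 1 < E₀)
    (hM : ∀ (j : ℕ) (E : ℝ), E₀ ≤ E → E < ET → (j : ℝ) + τ ≤ E → kernelTest2p F D E j)
    (hT : ∀ E : ℝ, ET ≤ E → ∀ j : ℕ, (j : ℝ) ≤ E → kernelTest2p F D E j) :
    ∀ ℓ : ℕ, ∀ Δ : ℝ, unitarityBound3D ℓ ≤ Δ → E₀ ≤ Δ → Pos2p F.toFunctional D Δ ℓ := by
  intro ℓ Δ hbd hΔ0
  by_cases hr : IsRegularPoint3D Δ ℓ
  · exact pos2p_of_forall_sector2pForm_nonneg F D fun G hG =>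
      sector2pForm_nonneg_heavy F D hτ1 hτ0 hE₀ hM hT (lt_of_le_of_ne hbd (Ne.symm hr.1)) hr.2 hΔ0 hG
  · refine pos2p_of_eventually_right F D hr ?_
    filter_upwards [eventually_isRegularPoint3D_nhdsGT_of_bound_le hbd, self_mem_nhdsWithin]
      with Δ' hΔ' hgt
    have hgt' : Δ < Δ' := Set.mem_Ioi.1 hgt
    exact ⟨hΔ', fun G hG => sector2pForm_nonneg_heavy F D hτ1 hτ0 hE₀ hM hT (lt_of_le_of_lt hbd hgt')
      hΔ'.2 (hΔ0.trans hgt'.le) hG⟩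

/-- **Heavy range, sector `1`, all points** (certificate constant `κ > 0`).
[cite: KosPolandSimmonsduffin2014, §3.3 eq. (3.16), §4 eqs. (4.2)–(4.3)] [cite: ChesterEtAl2020, §3.1 (functional conditions)] -/
theorem pos1_heavy (F : ScanFunctional) (D : Dims) {κ E₀ ET τ : ℝ} (hκ : 0 < κ) (hτ1 : τ ≤ 1)
    (hτ0 : τ ≤ E₀) (hE₀ : 1 < E₀)
    (hM : ∀ (j : ℕ) (E : ℝ), E₀ ≤ E → E < ET → (j : ℝ) + τ ≤ E → kernelTest1 F D κ E j)
    (hT : ∀ E : ℝ, ET ≤ E → ∀ j : ℕ, (j : ℝ) ≤ E → kernelTest1 F D κ E j) :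
    ∀ ℓ : ℕ, ∀ Δ : ℝ, unitarityBound3D ℓ ≤ Δ → E₀ ≤ Δ → Pos1 F.toFunctional D Δ ℓ := by
  intro ℓ Δ hbd hΔ0
  by_cases hr : IsRegularPoint3D Δ ℓ
  · exact pos1_of_forall_sector1Form_nonneg F D fun G hG =>
      sector1Form_nonneg_heavy F D (abs_neg_one_pow_le_one ℓ) hκ hτ1 hτ0 hE₀ hM hT
        (lt_of_le_of_ne hbd (Ne.symm hr.1)) hr.2 hΔ0 hG
  · refine pos1_of_eventually_right F D hr ?_
    filter_upwards [eventually_isRegularPoint3D_nhdsGT_of_bound_le hbd, self_mem_nhdsWithin]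
      with Δ' hΔ' hgt
    have hgt' : Δ < Δ' := Set.mem_Ioi.1 hgt
    exact ⟨hΔ', fun G hG => sector1Form_nonneg_heavy F D (abs_neg_one_pow_le_one ℓ) hκ hτ1 hτ0 hE₀ hM hT
      (lt_of_le_of_lt hbd hgt') hΔ'.2 (hΔ0.trans hgt'.le) hG⟩

/-! ### §5 Cell tails from (M)/(T) -/

/-- **Cell tails from (M)/(T), sector `2⁺`.**  For a cell `[lo, hi]` strictly above the unitarity bound
with `ℓ + τ ≤ lo`, a head set `S` containing every in-range `(n, j)` with `n < N₀`, and `lo + N₀ ≥ E₀`: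
the kernel tests (M) on `E ∈ [E₀, E_T)`, `j + τ ≤ E` and (T) on `E ≥ E_T`, `j ≤ E` give the tail
hypothesis of `O2ChargedSectorsCells.pos2p_on_cell_Ico`. [cite: HogervorstRychkov2013, §3 eqs. (3.6), (3.9)] -/
theorem cellTail2p_of_termwise (F : ScanFunctional) (D : Dims) {ℓ : ℕ} {lo hi E₀ ET τ : ℝ}
    (ha : unitarityBound3D ℓ < lo) (hτ : (ℓ : ℝ) + τ ≤ lo) (N₀ : ℕ) (hN : E₀ ≤ lo + N₀)
    (S : Finset (ℕ × ℕ)) (hS : ∀ q : ℕ × ℕ, InDescendantRange ℓ q.1 q.2 → q.1 < N₀ → q ∈ S)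
    (hM : ∀ (j : ℕ) (E : ℝ), E₀ ≤ E → E < ET → (j : ℝ) + τ ≤ E → kernelTest2p F D E j)
    (hT : ∀ E : ℝ, ET ≤ E → ∀ j : ℕ, (j : ℝ) ≤ E → kernelTest2p F D E j) :
    ∀ q : ℕ × ℕ, q ∉ S → InDescendantRange ℓ q.1 q.2 →
      ∀ Δ ∈ Icc lo hi, ∀ b z : ℝ, 0 ≤ dom2pTermForm F D Δ ℓ q.1 q.2 b z := by
  intro q hq hr Δ hΔ b z
  refine dom2pTermForm_nonneg_of_kernelTest F D ?_ b z
  have hn : (N₀ : ℝ) ≤ (q.1 : ℝ) := by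
    have : ¬ q.1 < N₀ := fun h => hq (hS q hr h)
    exact_mod_cast not_lt.1 this
  have hE0 : E₀ ≤ Δ + (q.1 : ℝ) := by linarith [hΔ.1]
  have hj : (q.2 : ℝ) ≤ (ℓ : ℝ) + (q.1 : ℝ) := by exact_mod_cast hr.2.1
  have hjE : (q.2 : ℝ) + τ ≤ Δ + (q.1 : ℝ) := by linarith [hΔ.1]
  have hjE' : (q.2 : ℝ) ≤ Δ + (q.1 : ℝ) := by linarith [hΔ.1, natCast_add_half_le_unitarityBound3D ℓ]
  by_cases hlt : Δ + (q.1 : ℝ) < ET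
  · exact hM q.2 _ hE0 hlt hjE
  · exact hT _ (not_lt.1 hlt) q.2 hjE'

/-- **Cell tails from (M)/(T), sector `1`** (certificate constant `κ`).
[cite: HogervorstRychkov2013, §3 eqs. (3.6), (3.9)] -/
theorem cellTail1_of_termwise (F : ScanFunctional) (D : Dims) (κ : ℝ) {ℓ : ℕ} {lo hi E₀ ET τ : ℝ}
    (ha : unitarityBound3D ℓ < lo) (hτ : (ℓ : ℝ) + τ ≤ lo) (N₀ : ℕ) (hN : E₀ ≤ lo + N₀)
    (S : Finset (ℕ × ℕ)) (hS : ∀ q : ℕ × ℕ, InDescendantRange ℓ q.1 q.2 → q.1 < N₀ → q ∈ S)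
    (hM : ∀ (j : ℕ) (E : ℝ), E₀ ≤ E → E < ET → (j : ℝ) + τ ≤ E → kernelTest1 F D κ E j)
    (hT : ∀ E : ℝ, ET ≤ E → ∀ j : ℕ, (j : ℝ) ≤ E → kernelTest1 F D κ E j) :
    ∀ q : ℕ × ℕ, q ∉ S → InDescendantRange ℓ q.1 q.2 →
      ∀ Δ ∈ Icc lo hi, ∀ x y : ℝ, 0 ≤ dom1TermForm F D κ Δ ℓ q.1 q.2 x y := by
  intro q hq hr Δ hΔ x y
  refine dom1TermForm_nonneg_of_kernelTest F D ?_ x y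
  have hn : (N₀ : ℝ) ≤ (q.1 : ℝ) := by
    have : ¬ q.1 < N₀ := fun h => hq (hS q hr h)
    exact_mod_cast not_lt.1 this
  have hE0 : E₀ ≤ Δ + (q.1 : ℝ) := by linarith [hΔ.1]
  have hj : (q.2 : ℝ) ≤ (ℓ : ℝ) + (q.1 : ℝ) := by exact_mod_cast hr.2.1
  have hjE : (q.2 : ℝ) + τ ≤ Δ + (q.1 : ℝ) := by linarith [hΔ.1]
  have hjE' : (q.2 : ℝ) ≤ Δ + (q.1 : ℝ) := by linarith [hΔ.1, natCast_add_half_le_unitarityBound3D ℓ]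
  by_cases hlt : Δ + (q.1 : ℝ) < ET
  · exact hM q.2 _ hE0 hlt hjE
  · exact hT _ (not_lt.1 hlt) q.2 hjE'

end Literature.MathematicalPhysics.QuantumFieldTheory.O2ChargedSectorsTail
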